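import Literature.NumberTheory.Sieve.SmoothCountSaddleCoreSmallAlpha
import Literature.NumberTheory.Sieve.SmoothCountSaddleRegimeBPrep
import Literature.NumberTheory.Sieve.SmoothSaddlePointPhiHigher
import HarnessLib

/-!
# Hildebrand–Tenenbaum's Theorem 1 in the range `y ≤ 8 (log x)³`: relative error bounds

Topic `Literature/NumberTheory/Sieve`; a PROVED file toward `Literature.NumberTheory.Sieve.HTLocalBehaviour`
[HildebrandTenenbaum1986, Thm 3]. We prove the saddle-point evaluation
`Ψ(x, y) = x^α ζ(α, y)/(α√(2πφ₂(α, y))) (1 + O(log y/log x + log y/y))` uniformly for `y₀ ≤ y ≤ x`,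
`y ≤ 8 (log x)³` [HildebrandTenenbaum1986, Thm 1 in that range], WITHOUT zero-free-region input: the analytic
core `GaussSaddle.abs_rpow_mul_card_sub_main_le_tau` (Gaussian-smoothed Perron formula on `Re s = α` with the
window `τ = √(40 log y)/√φ₂`, Gaussian width `T_g = max(4, αū/1000)`, `T_d = T_g log y/2`), fed with the
near-axis bounds of `RegimeB.exists_nearAxis_params`, the ELEMENTARY middle-range decay
`RegimeB.exists_norm_smoothZetaC_le_exp_neg_mid` (`|t| ≤ y/(100 log y)` suffices because `α log x ≤ π(y)`), and
the uniform orders of `α`, `φ₂`, `φ₃`, `φ₄` (Lemmas 2 and 4). Every error is `≪ 1/ū` with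
`1/ū = (1 + log x/y)/u = log y/log x + log y/y`:

* `window_rel_le`, `tail_rel_le`, `mean_rel_le` — the window, tail and Gaussian-mean errors of the core are
  `≪ 1/ū` times the main term (the theorem itself is assembled in `SmoothCountSaddleRegimeB`).

## References

* [HildebrandTenenbaum1986] A. Hildebrand, G. Tenenbaum, Trans. AMS 296 (1986) 265–290, Theorem 1 and §§3–5.
-/

noncomputable section

open Complex Real Finset Filter MeasureTheory

namespace Literature.NumberTheory.Sieve

namespace RegimeB

/-! ### Small helpers -/

/-- `log^n Y ≤ c Y^s` eventually (`s, c > 0`). [folklore] -/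
theorem eventually_log_pow_le (n : ℕ) {s c : ℝ} (hs : 0 < s) (hc : 0 < c) :
    ∀ᶠ Y : ℝ in atTop, Real.log Y ^ n ≤ c * Y ^ s := by
  have h := (isLittleO_log_rpow_rpow_atTop (n : ℝ) hs).def hc
  filter_upwards [h, eventually_ge_atTop (1 : ℝ)] with Y hY hY1
  have h1 : 0 ≤ Real.log Y := Real.log_nonneg hY1
  rw [Real.rpow_natCast, Real.norm_of_nonneg (pow_nonneg h1 n),
    Real.norm_of_nonneg (Real.rpow_nonneg (by linarith) s)] at hY
  exact hY

/-- `-φ₁(σ, y) ≤ π(y)/σ` for every `σ > 0` (`p^σ - 1 ≥ σ log p`). [cite: HildebrandTenenbaum1986, Lemma 2 (3.3)] -/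
theorem saddleSum_le_card_div' {σ : ℝ} (hσ : 0 < σ) (y : ℕ) :
    saddleSum σ y ≤ #(Nat.primesLE y) / σ := by
  rw [saddleSum, Finset.card_eq_sum_ones, Nat.cast_sum, Finset.sum_div]
  refine Finset.sum_le_sum fun p hp => ?_
  obtain ⟨-, hpp⟩ := Nat.mem_primesLE.1 hp
  have hp1 : (1 : ℝ) < p := by exact_mod_cast hpp.one_lt
  have hlogp : 0 < Real.log p := Real.log_pos hp1
  have h1 : σ * Real.log p ≤ (p : ℝ) ^ σ - 1 := by
    rw [Real.rpow_def_of_pos (by linarith), mul_comm]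
    have := Real.add_one_le_exp (σ * Real.log p)
    rw [mul_comm] at this
    linarith
  have hD : 0 < (p : ℝ) ^ σ - 1 := lt_of_lt_of_le (mul_pos hσ hlogp) h1
  push_cast
  rw [div_le_div_iff₀ hD hσ]
  linarith

/-- `√φ · √(c/φ) = √c` for `φ > 0`. [folklore] -/
theorem sqrt_mul_sqrt_div {φ : ℝ} (hφ : 0 < φ) (c : ℝ) : Real.sqrt φ * Real.sqrt (c / φ) = Real.sqrt c := by
  rw [← Real.sqrt_mul hφ.le, mul_div_cancel₀ _ hφ.ne']

/-- `1 + v² ≤ (1 + v)²` for `v ≥ 0`. [folklore] -/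
theorem one_add_sq_le_sq {v : ℝ} (hv : 0 ≤ v) : 1 + v ^ 2 ≤ (1 + v) ^ 2 := by nlinarith

/-- `1 + v³ ≤ (1 + v)³` for `v ≥ 0`. [folklore] -/
theorem one_add_cube_le_cube {v : ℝ} (hv : 0 ≤ v) : 1 + v ^ 3 ≤ (1 + v) ^ 3 := by
  nlinarith [sq_nonneg v, mul_nonneg hv (sq_nonneg v)]

/-- `exp(-n log y) = 1/y^n`. [folklore] -/
theorem exp_neg_natMul_log {y : ℝ} (hy : 0 < y) (n : ℕ) : Real.exp (-((n : ℝ) * Real.log y)) = (y ^ n)⁻¹ := by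
  rw [Real.exp_neg, ← Real.log_pow, Real.exp_log (pow_pos hy n)]

/-! ### Relative bounds for the window, the tails, and the mean -/

/-- `√(4π/φ) = 2√π/√φ`. [folklore] -/
theorem sqrt_four_pi_div (φ : ℝ) : Real.sqrt (4 * Real.pi / φ) = 2 * Real.sqrt Real.pi / Real.sqrt φ := by
  rw [Real.sqrt_div (by positivity : (0 : ℝ) ≤ 4 * Real.pi), Real.sqrt_mul (by norm_num),
    show Real.sqrt 4 = 2 by rw [show (4 : ℝ) = 2 ^ 2 by norm_num, Real.sqrt_sq (by norm_num)]]

set_option maxHeartbeats 10000000 in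
/-- **Window, relative size.** With `G = α√φ`, `τ² = 40 L/φ` and the ratio bounds `Φ₄/φ² ≤ c₄Q`,
`Φ₃/(αφ²) ≤ c₃Q`, `Φ₃²/φ³ ≤ c₃₃Q`, `1/φ ≤ c_φQ`, `1/(α²φ) ≤ c_gQ`, `Φ₄τ/(αφ²) ≤ c'Q`, `e^{-10L} ≤ Q ≤ 1`, the window
error `K_w` of `GaussSaddle.abs_rpow_mul_card_sub_main_le_tau` satisfies
`G K_w ≤ (4 + 16(c_g + c_φ) + 32(c₄ + c₃ + 2c') + 20c₃₃ + 8800c₄²) Q`. [cite: HildebrandTenenbaum1986, §5] -/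
theorem window_rel_le {α φ Φ₃ Φ₄ τ Tg L Q c4 c3 c33 cφi cg c4τ : ℝ} (hα0 : 0 < α) (hφ0 : 0 < φ)
    (hΦ₃0 : 0 ≤ Φ₃) (hΦ₄0 : 0 ≤ Φ₄) (hτ0 : 0 ≤ τ) (hτsq : τ ^ 2 = 40 * L / φ) (hTg4 : 4 ≤ Tg)
    (hQ0 : 0 ≤ Q) (hQ1 : Q ≤ 1) (hc3 : 0 ≤ c3) (hcφi : 0 ≤ cφi) (hcg : 0 ≤ cg)
    (hR4 : Φ₄ / φ ^ 2 ≤ c4 * Q) (hR3 : Φ₃ / (α * φ ^ 2) ≤ c3 * Q) (hR33 : Φ₃ ^ 2 / φ ^ 3 ≤ c33 * Q)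
    (hφinv : 1 / φ ≤ cφi * Q) (hGinv : 1 / (α ^ 2 * φ) ≤ cg * Q) (hR4τ : Φ₄ * τ / (α * φ ^ 2) ≤ c4τ * Q)
    (hexpQ : Real.exp (-(10 * L)) ≤ Q) :
    (α * Real.sqrt φ) * (‖((α : ℝ) : ℂ)⁻¹‖ * (Real.exp (-(φ / 4) * τ ^ 2) * Real.sqrt (4 * Real.pi / φ)) +
        Real.sqrt (4 * Real.pi / φ) *
          (Real.exp 1 * (1 / α ^ 3 + 1 / (2 * Tg ^ 2 * α)) * (4 * 1 / (Real.exp 1 * φ)) ^ 1 +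
            (‖((α : ℝ) : ℂ)⁻¹‖ * Φ₄ + ‖-I / ((α : ℝ) : ℂ) ^ 2‖ * (Φ₃ / 3 + 2 * Φ₄ * τ)) *
              (4 * 2 / (Real.exp 1 * φ)) ^ 2 +
            (‖((α : ℝ) : ℂ)⁻¹‖ * Φ₃ ^ 2 / 18) * (4 * 3 / (Real.exp 1 * φ)) ^ 3 +
            2 * ‖((α : ℝ) : ℂ)⁻¹‖ * Φ₄ ^ 2 * (4 * 4 / (Real.exp 1 * φ)) ^ 4)) ≤
      (4 + 16 * (cg + cφi) + 32 * (c4 + c3 + 2 * c4τ) + 20 * c33 + 8800 * c4 ^ 2) * Q := by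
  have hnormA0 : ‖((α : ℝ) : ℂ)⁻¹‖ = 1 / α := by
    rw [norm_inv, Complex.norm_real, Real.norm_eq_abs, abs_of_pos hα0, one_div]
  have hnormA1 : ‖-I / ((α : ℝ) : ℂ) ^ 2‖ = 1 / α ^ 2 := by
    rw [norm_div, norm_neg, Complex.norm_I, norm_pow, Complex.norm_real, Real.norm_eq_abs, abs_of_pos hα0]
  set sφ : ℝ := Real.sqrt φ with hsφ
  have hsφ0 : 0 < sφ := Real.sqrt_pos.2 hφ0
  set A : ℝ := 2 * Real.sqrt Real.pi with hA
  have hsπ : Real.sqrt Real.pi ≤ 1.7725 := by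
    rw [Real.sqrt_le_left (by norm_num)]; have := Real.pi_lt_d6; nlinarith
  have hA0 : 0 < A := by have := Real.sqrt_pos.2 Real.pi_pos; positivity
  have hA1 : A ≤ 3.545 := by rw [hA]; linarith
  have hR : Real.sqrt (4 * Real.pi / φ) = A / sφ := by rw [hA, hsφ]; exact sqrt_four_pi_div φ
  set E : ℝ := Real.exp 1 with hE
  have hE0 : 0 < E := Real.exp_pos 1
  have hE27 : 2.7 ≤ E := by have := Real.exp_one_gt_d9; rw [hE]; linarith
  have hX : Real.exp (-(φ / 4) * τ ^ 2) = Real.exp (-(10 * L)) := by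
    rw [hτsq]; congr 1; field_simp; ring
  have hTg0 : 0 < Tg := by linarith
  rw [hnormA0, hnormA1, hR, hX]
  -- the algebraic form, piece by piece
  set X : ℝ := Real.exp (-(10 * L)) with hXdef
  have hαne : α ≠ 0 := hα0.ne'
  have hsne : sφ ≠ 0 := hsφ0.ne'
  have hφne : φ ≠ 0 := hφ0.ne'
  have hEne : E ≠ 0 := hE0.ne'
  have hdist : (α * sφ) * (1 / α * (X * (A / sφ)) +
        A / sφ * (E * (1 / α ^ 3 + 1 / (2 * Tg ^ 2 * α)) * (4 * 1 / (E * φ)) ^ 1 +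
          (1 / α * Φ₄ + 1 / α ^ 2 * (Φ₃ / 3 + 2 * Φ₄ * τ)) * (4 * 2 / (E * φ)) ^ 2 +
          (1 / α * Φ₃ ^ 2 / 18) * (4 * 3 / (E * φ)) ^ 3 + 2 * (1 / α) * Φ₄ ^ 2 * (4 * 4 / (E * φ)) ^ 4)) =
      (α * sφ) * (1 / α * (X * (A / sφ))) +
        (α * sφ) * (A / sφ * (E * (1 / α ^ 3 + 1 / (2 * Tg ^ 2 * α)) * (4 * 1 / (E * φ)) ^ 1)) +
        (α * sφ) * (A / sφ * ((1 / α * Φ₄ + 1 / α ^ 2 * (Φ₃ / 3 + 2 * Φ₄ * τ)) * (4 * 2 / (E * φ)) ^ 2)) +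
        (α * sφ) * (A / sφ * ((1 / α * Φ₃ ^ 2 / 18) * (4 * 3 / (E * φ)) ^ 3)) +
        (α * sφ) * (A / sφ * (2 * (1 / α) * Φ₄ ^ 2 * (4 * 4 / (E * φ)) ^ 4)) := by ring
  have c1 : α * sφ * (A / sφ) = α * A := by field_simp
  have e1 : (α * sφ) * (1 / α * (X * (A / sφ))) = A * X := by
    calc (α * sφ) * (1 / α * (X * (A / sφ))) = (α * sφ * (A / sφ)) * (1 / α) * X := by ring
      _ = α * A * (1 / α) * X := by rw [c1]
      _ = A * X := by field_simp
  have e2 : (α * sφ) * (A / sφ * (E * (1 / α ^ 3 + 1 / (2 * Tg ^ 2 * α)) * (4 * 1 / (E * φ)) ^ 1)) =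
      4 * A * (1 / (α ^ 2 * φ) + 1 / (2 * Tg ^ 2) * (1 / φ)) := by
    calc (α * sφ) * (A / sφ * (E * (1 / α ^ 3 + 1 / (2 * Tg ^ 2 * α)) * (4 * 1 / (E * φ)) ^ 1))
        = (α * sφ * (A / sφ)) * (E * (1 / α ^ 3 + 1 / (2 * Tg ^ 2 * α)) * (4 * 1 / (E * φ)) ^ 1) := by ring
      _ = α * A * (E * (1 / α ^ 3 + 1 / (2 * Tg ^ 2 * α)) * (4 * 1 / (E * φ)) ^ 1) := by rw [c1]
      _ = 4 * A * (1 / (α ^ 2 * φ) + 1 / (2 * Tg ^ 2) * (1 / φ)) := by field_simp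
  have e3 : (α * sφ) * (A / sφ * ((1 / α * Φ₄ + 1 / α ^ 2 * (Φ₃ / 3 + 2 * Φ₄ * τ)) * (4 * 2 / (E * φ)) ^ 2)) =
      64 * A / E ^ 2 * (Φ₄ / φ ^ 2 + 1 / 3 * (Φ₃ / (α * φ ^ 2)) + 2 * (Φ₄ * τ / (α * φ ^ 2))) := by
    calc (α * sφ) * (A / sφ * ((1 / α * Φ₄ + 1 / α ^ 2 * (Φ₃ / 3 + 2 * Φ₄ * τ)) * (4 * 2 / (E * φ)) ^ 2))
        = (α * sφ * (A / sφ)) * ((1 / α * Φ₄ + 1 / α ^ 2 * (Φ₃ / 3 + 2 * Φ₄ * τ)) * (4 * 2 / (E * φ)) ^ 2) := by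
          ring
      _ = α * A * ((1 / α * Φ₄ + 1 / α ^ 2 * (Φ₃ / 3 + 2 * Φ₄ * τ)) * (4 * 2 / (E * φ)) ^ 2) := by rw [c1]
      _ = 64 * A / E ^ 2 * (Φ₄ / φ ^ 2 + 1 / 3 * (Φ₃ / (α * φ ^ 2)) + 2 * (Φ₄ * τ / (α * φ ^ 2))) := by
          field_simp; ring
  have e4 : (α * sφ) * (A / sφ * ((1 / α * Φ₃ ^ 2 / 18) * (4 * 3 / (E * φ)) ^ 3)) =
      96 * A / E ^ 3 * (Φ₃ ^ 2 / φ ^ 3) := by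
    calc (α * sφ) * (A / sφ * ((1 / α * Φ₃ ^ 2 / 18) * (4 * 3 / (E * φ)) ^ 3))
        = (α * sφ * (A / sφ)) * ((1 / α * Φ₃ ^ 2 / 18) * (4 * 3 / (E * φ)) ^ 3) := by ring
      _ = α * A * ((1 / α * Φ₃ ^ 2 / 18) * (4 * 3 / (E * φ)) ^ 3) := by rw [c1]
      _ = 96 * A / E ^ 3 * (Φ₃ ^ 2 / φ ^ 3) := by field_simp; ring
  have e5 : (α * sφ) * (A / sφ * (2 * (1 / α) * Φ₄ ^ 2 * (4 * 4 / (E * φ)) ^ 4)) =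
      131072 * A / E ^ 4 * (Φ₄ / φ ^ 2) ^ 2 := by
    calc (α * sφ) * (A / sφ * (2 * (1 / α) * Φ₄ ^ 2 * (4 * 4 / (E * φ)) ^ 4))
        = (α * sφ * (A / sφ)) * (2 * (1 / α) * Φ₄ ^ 2 * (4 * 4 / (E * φ)) ^ 4) := by ring
      _ = α * A * (2 * (1 / α) * Φ₄ ^ 2 * (4 * 4 / (E * φ)) ^ 4) := by rw [c1]
      _ = 131072 * A / E ^ 4 * (Φ₄ / φ ^ 2) ^ 2 := by field_simp; ring
  rw [hdist, e1, e2, e3, e4, e5]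
  -- bound the five pieces
  have hE2p : (2.7 : ℝ) ^ 2 ≤ E ^ 2 := pow_le_pow_left₀ (by norm_num) hE27 2
  have hE3p : (2.7 : ℝ) ^ 3 ≤ E ^ 3 := pow_le_pow_left₀ (by norm_num) hE27 3
  have hE4p : (2.7 : ℝ) ^ 4 ≤ E ^ 4 := pow_le_pow_left₀ (by norm_num) hE27 4
  have h1 : A * X ≤ 4 * Q := by
    have hX0 : 0 < X := Real.exp_pos _
    have := mul_le_mul hA1 hexpQ hX0.le (by norm_num)
    linarith
  have h2 : 4 * A * (1 / (α ^ 2 * φ) + 1 / (2 * Tg ^ 2) * (1 / φ)) ≤ 16 * (cg + cφi) * Q := by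
    have hT : 1 / (2 * Tg ^ 2) ≤ 1 / 32 := one_div_le_one_div_of_le (by norm_num) (by nlinarith)
    have hφi0 : 0 ≤ 1 / φ := by positivity
    have h3 : 1 / (2 * Tg ^ 2) * (1 / φ) ≤ 1 / 32 * (cφi * Q) :=
      mul_le_mul hT hφinv hφi0 (by norm_num)
    have h4 : 0 ≤ cg * Q := by positivity
    have h5 : 0 ≤ cφi * Q := by positivity
    have h6 : 1 / (α ^ 2 * φ) + 1 / (2 * Tg ^ 2) * (1 / φ) ≤ cg * Q + 1 / 32 * (cφi * Q) := by linarith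
    have h7 : 0 ≤ 1 / (α ^ 2 * φ) + 1 / (2 * Tg ^ 2) * (1 / φ) := by positivity
    have h8 : 4 * A * (1 / (α ^ 2 * φ) + 1 / (2 * Tg ^ 2) * (1 / φ)) ≤ 4 * 3.545 * (cg * Q + 1 / 32 * (cφi * Q)) :=
      mul_le_mul (by linarith) h6 h7 (by norm_num)
    linarith
  have h3 : 64 * A / E ^ 2 * (Φ₄ / φ ^ 2 + 1 / 3 * (Φ₃ / (α * φ ^ 2)) + 2 * (Φ₄ * τ / (α * φ ^ 2))) ≤
      32 * (c4 + c3 + 2 * c4τ) * Q := by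
    have hin0 : 0 ≤ Φ₄ / φ ^ 2 + 1 / 3 * (Φ₃ / (α * φ ^ 2)) + 2 * (Φ₄ * τ / (α * φ ^ 2)) := by positivity
    have hin : Φ₄ / φ ^ 2 + 1 / 3 * (Φ₃ / (α * φ ^ 2)) + 2 * (Φ₄ * τ / (α * φ ^ 2)) ≤ (c4 + c3 + 2 * c4τ) * Q := by
      have : 0 ≤ c3 * Q := by positivity
      linarith [hR4, hR3, hR4τ]
    have hcoef : 64 * A / E ^ 2 ≤ 32 := by
      rw [div_le_iff₀ (by positivity)]; linarith [hA1, hE2p]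
    have hcoef0 : 0 ≤ 64 * A / E ^ 2 := by positivity
    calc 64 * A / E ^ 2 * (Φ₄ / φ ^ 2 + 1 / 3 * (Φ₃ / (α * φ ^ 2)) + 2 * (Φ₄ * τ / (α * φ ^ 2)))
        ≤ 32 * ((c4 + c3 + 2 * c4τ) * Q) := mul_le_mul hcoef hin hin0 (by norm_num)
      _ = 32 * (c4 + c3 + 2 * c4τ) * Q := by ring
  have h4 : 96 * A / E ^ 3 * (Φ₃ ^ 2 / φ ^ 3) ≤ 20 * c33 * Q := by
    have hcoef : 96 * A / E ^ 3 ≤ 20 := by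
      rw [div_le_iff₀ (by positivity)]; linarith [hA1, hE3p]
    have h0 : 0 ≤ Φ₃ ^ 2 / φ ^ 3 := by positivity
    calc 96 * A / E ^ 3 * (Φ₃ ^ 2 / φ ^ 3) ≤ 20 * (c33 * Q) := mul_le_mul hcoef hR33 h0 (by norm_num)
      _ = 20 * c33 * Q := by ring
  have h5 : 131072 * A / E ^ 4 * (Φ₄ / φ ^ 2) ^ 2 ≤ 8800 * c4 ^ 2 * Q := by
    have hcoef : 131072 * A / E ^ 4 ≤ 8800 := by
      rw [div_le_iff₀ (by positivity)]; linarith [hA1, hE4p]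
    have h0 : 0 ≤ Φ₄ / φ ^ 2 := by positivity
    have hsq : (Φ₄ / φ ^ 2) ^ 2 ≤ (c4 * Q) ^ 2 := pow_le_pow_left₀ h0 hR4 2
    have hsq2 : (c4 * Q) ^ 2 ≤ c4 ^ 2 * Q := by
      rw [mul_pow]; exact mul_le_mul_of_nonneg_left (by nlinarith) (by positivity)
    calc 131072 * A / E ^ 4 * (Φ₄ / φ ^ 2) ^ 2 ≤ 8800 * (c4 ^ 2 * Q) :=
          mul_le_mul hcoef (hsq.trans hsq2) (by positivity) (by norm_num)
      _ = 8800 * c4 ^ 2 * Q := by ring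
  linarith [h1, h2, h3, h4, h5]

set_option maxHeartbeats 3000000 in
/-- **Tails, relative size.** With `G = α√φ ≤ y²`, `aK = 4φ/π²`, `K ≥ max(64, 17L)`, `τ² = 40L/φ`, `T_d = T_g L/2`,
`ε ≤ y^{-9}`, `T_d ≤ y`, `L = log y ≥ 100`, `1/y ≤ Q`: the tail error `K_t` of
`GaussSaddle.abs_rpow_mul_card_sub_main_le_tau` satisfies `G K_t ≤ 70 Q`. [cite: HildebrandTenenbaum1986, §5] -/
theorem tail_rel_le {α φ τ Tg Td L ε a K Q : ℝ} {y : ℕ} (hα0 : 0 < α) (hφ0 : 0 < φ)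
    (hτsq : τ ^ 2 = 40 * L / φ) (hTg4 : 4 ≤ Tg) (hTd : Td = Tg * L / 2) (ha : 0 < a) (hK64 : 64 ≤ K)
    (hK17 : 17 * L ≤ K) (haK : a * K = 4 * φ / Real.pi ^ 2) (hL : L = Real.log y) (hL100 : 100 ≤ L)
    (hy1 : (1 : ℝ) < y) (hε0 : 0 ≤ ε) (hεy : ε ≤ ((y : ℝ) ^ 9)⁻¹) (hTdy : Td ≤ y)
    (hG : α * Real.sqrt φ ≤ (y : ℝ) ^ 2) (hQy : 1 / (y : ℝ) ≤ Q) :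
    (α * Real.sqrt φ) * ((1 + a * τ ^ 2) ^ (-(K / 4)) *
          (Real.sqrt (8 * Real.pi / (a * K)) + 2 * (2 : ℝ) ^ (-(K / 4)) * Real.pi / Real.sqrt a) / α +
        6 * ε * Real.log y + 2 * Real.pi / 3 * ε * Td +
        2 * Real.pi * (4 * Tg ^ 2 * Real.exp (-1) * Real.exp (-(Td ^ 2 / (4 * Tg ^ 2)))) / Td ^ 2) ≤ 70 * Q := by
  have hπ := Real.pi_pos
  have hπ3 := Real.pi_gt_three
  have hπ4 : Real.pi < 3.1416 := Real.pi_lt_d4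
  have hy0 : (0 : ℝ) < y := by linarith
  set sφ : ℝ := Real.sqrt φ with hsφ
  have hsφ0 : 0 < sφ := Real.sqrt_pos.2 hφ0
  have hsφsq : sφ ^ 2 = φ := Real.sq_sqrt hφ0.le
  set G : ℝ := α * sφ with hGdef
  have hG0 : 0 < G := by positivity
  have hK0 : 0 < K := by linarith
  have hL0 : 0 < L := by linarith
  have hTg0 : 0 < Tg := by linarith
  have hTd0 : 0 < Td := by rw [hTd]; positivity
  have hQ0 : 0 ≤ Q := le_trans (by positivity) hQy
  -- `a = 4φ/(π²K)`
  have haval : a = 4 * φ / (Real.pi ^ 2 * K) := by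
    rw [eq_div_iff (by positivity)]
    calc a * (Real.pi ^ 2 * K) = (a * K) * Real.pi ^ 2 := by ring
      _ = 4 * φ / Real.pi ^ 2 * Real.pi ^ 2 := by rw [haK]
      _ = 4 * φ := by field_simp
  -- `D ≤ y^{-2}`
  set D : ℝ := (1 + a * τ ^ 2) ^ (-(K / 4)) with hD
  have hV : a * τ ^ 2 = 160 * L / (Real.pi ^ 2 * K) := by rw [haval, hτsq]; field_simp; ring
  have hV0 : 0 ≤ a * τ ^ 2 := by positivity
  have hπsq : 9.85 ≤ Real.pi ^ 2 := by nlinarith [Real.pi_gt_d2]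
  have hπsq' : Real.pi ^ 2 ≤ 9.87 := by nlinarith [Real.pi_lt_d4, Real.pi_pos]
  have hV1 : a * τ ^ 2 ≤ 1 := by
    rw [hV, div_le_one (by positivity)]
    have := mul_le_mul_of_nonneg_left hK17 (by positivity : (0 : ℝ) ≤ Real.pi ^ 2)
    nlinarith
  have hD0 : 0 < D := Real.rpow_pos_of_pos (by positivity) _
  have hDexp : D ≤ Real.exp (-(2 * L)) := by
    refine (rpow_neg_quarter_le_exp hK0.le hV0 hV1).trans (Real.exp_le_exp.2 (neg_le_neg ?_))
    rw [hV, show K * (160 * L / (Real.pi ^ 2 * K)) / 8 = 20 * L / Real.pi ^ 2 by field_simp; ring,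
      le_div_iff₀ (by positivity)]
    nlinarith [hπsq', hL0]
  have hy2 : Real.exp (-(2 * L)) = ((y : ℝ) ^ 2)⁻¹ := by
    have h := exp_neg_natMul_log hy0 2; rw [hL]; exact_mod_cast h
  have hDy : D ≤ ((y : ℝ) ^ 2)⁻¹ := hy2 ▸ hDexp
  have hy2Q : ((y : ℝ) ^ 2)⁻¹ ≤ Q := by
    refine le_trans ?_ hQy
    rw [inv_eq_one_div]; exact one_div_le_one_div_of_le hy0 (by nlinarith)
  have hDQ : D ≤ Q := hDy.trans hy2Q
  -- `sφ √(8π/(aK)) = √(2π³) ≤ 7.9`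
  have hT1 : sφ * Real.sqrt (8 * Real.pi / (a * K)) ≤ 7.9 := by
    rw [haK, show 8 * Real.pi / (4 * φ / Real.pi ^ 2) = 2 * Real.pi ^ 3 / φ by field_simp; ring, hsφ,
      sqrt_mul_sqrt_div hφ0 _, Real.sqrt_le_left (by norm_num)]
    nlinarith
  -- `sφ/√a = π√K/2` and `√K 2^{-K/4} ≤ 1`
  have hsa : sφ / Real.sqrt a = Real.pi / 2 * Real.sqrt K := by
    rw [hsφ, ← Real.sqrt_div hφ0.le, haval, show φ / (4 * φ / (Real.pi ^ 2 * K)) = (Real.pi / 2) ^ 2 * K by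
      field_simp; ring, Real.sqrt_mul (by positivity), Real.sqrt_sq (by positivity)]
  have hsK : Real.sqrt K * (2 : ℝ) ^ (-(K / 4)) ≤ 1 := by
    have h1 := sqrt_le_two_rpow_div_eight hK64
    have h2 : (2 : ℝ) ^ (K / 8) * (2 : ℝ) ^ (-(K / 4)) = (2 : ℝ) ^ (-(K / 8)) := by
      rw [← Real.rpow_add (by norm_num)]; ring_nf
    have h3 : (2 : ℝ) ^ (-(K / 8)) ≤ 1 := Real.rpow_le_one_of_one_le_of_nonpos (by norm_num) (by linarith)
    have h4 : 0 < (2 : ℝ) ^ (-(K / 4)) := Real.rpow_pos_of_pos (by norm_num) _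
    calc Real.sqrt K * (2 : ℝ) ^ (-(K / 4)) ≤ (2 : ℝ) ^ (K / 8) * (2 : ℝ) ^ (-(K / 4)) :=
          mul_le_mul_of_nonneg_right h1 h4.le
      _ = _ := h2
      _ ≤ 1 := h3
  -- the first tail piece
  have hpiece1 : G * (D * (Real.sqrt (8 * Real.pi / (a * K)) + 2 * (2 : ℝ) ^ (-(K / 4)) * Real.pi / Real.sqrt a) / α)
      ≤ 18 * Q := by
    have hsa0 : 0 < Real.sqrt a := Real.sqrt_pos.2 ha
    have heq : G * (D * (Real.sqrt (8 * Real.pi / (a * K)) + 2 * (2 : ℝ) ^ (-(K / 4)) * Real.pi / Real.sqrt a) / α)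
        = D * (sφ * Real.sqrt (8 * Real.pi / (a * K)) + 2 * Real.pi * ((2 : ℝ) ^ (-(K / 4)) * (sφ / Real.sqrt a))) := by
      rw [hGdef]; field_simp
    rw [heq, hsa]
    have h2 : (2 : ℝ) ^ (-(K / 4)) * (Real.pi / 2 * Real.sqrt K) ≤ Real.pi / 2 := by
      have := mul_le_mul_of_nonneg_left hsK (by positivity : (0 : ℝ) ≤ Real.pi / 2)
      calc (2 : ℝ) ^ (-(K / 4)) * (Real.pi / 2 * Real.sqrt K) = Real.pi / 2 * (Real.sqrt K * (2 : ℝ) ^ (-(K / 4))) := by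
            ring
        _ ≤ Real.pi / 2 * 1 := this
        _ = Real.pi / 2 := mul_one _
    have h3 : sφ * Real.sqrt (8 * Real.pi / (a * K)) + 2 * Real.pi * ((2 : ℝ) ^ (-(K / 4)) * (Real.pi / 2 * Real.sqrt K))
        ≤ 18 := by nlinarith [h2, hT1]
    have h4 : 0 ≤ sφ * Real.sqrt (8 * Real.pi / (a * K)) + 2 * Real.pi * ((2 : ℝ) ^ (-(K / 4)) * (Real.pi / 2 * Real.sqrt K)) := by
      positivity
    calc D * (sφ * Real.sqrt (8 * Real.pi / (a * K)) + 2 * Real.pi * ((2 : ℝ) ^ (-(K / 4)) * (Real.pi / 2 * Real.sqrt K)))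
        ≤ Q * 18 := mul_le_mul hDQ h3 h4 hQ0
      _ = 18 * Q := mul_comm _ _
  -- powers of `y`
  have hGε : G * ε ≤ 1 / (y : ℝ) ^ 7 := by
    calc G * ε ≤ (y : ℝ) ^ 2 * ((y : ℝ) ^ 9)⁻¹ := mul_le_mul hG hεy hε0 (by positivity)
      _ = 1 / (y : ℝ) ^ 7 := by rw [eq_div_iff (by positivity)]; field_simp
  have hy7 : 1 / (y : ℝ) ^ 7 ≤ 1 / y := one_div_le_one_div_of_le hy0 (by nlinarith [pow_le_pow_right₀ hy1.le (show 1 ≤ 7 by norm_num)])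
  have hLy : L ≤ y := by
    rw [hL]; exact (Real.log_le_sub_one_of_pos hy0).trans (by linarith)
  have hpiece2 : G * (6 * ε * Real.log y) ≤ 6 * Q := by
    rw [← hL]
    have h1 : G * (6 * ε * L) = 6 * (G * ε) * L := by ring
    rw [h1]
    have h2 : G * ε * L ≤ 1 / (y : ℝ) ^ 7 * y := mul_le_mul hGε hLy hL0.le (by positivity)
    have h3 : 1 / (y : ℝ) ^ 7 * y ≤ 1 / y := by
      rw [div_mul_eq_mul_div, one_mul, div_le_div_iff₀ (by positivity) hy0]
      nlinarith [pow_le_pow_right₀ hy1.le (show 2 ≤ 7 by norm_num)]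
    nlinarith [hQy]
  have hpiece3 : G * (2 * Real.pi / 3 * ε * Td) ≤ 3 * Q := by
    have h1 : G * (2 * Real.pi / 3 * ε * Td) = 2 * Real.pi / 3 * ((G * ε) * Td) := by ring
    rw [h1]
    have h2 : G * ε * Td ≤ 1 / (y : ℝ) ^ 7 * y := mul_le_mul hGε hTdy hTd0.le (by positivity)
    have h3 : 1 / (y : ℝ) ^ 7 * y ≤ 1 / y := by
      rw [div_mul_eq_mul_div, one_mul, div_le_div_iff₀ (by positivity) hy0]
      nlinarith [pow_le_pow_right₀ hy1.le (show 2 ≤ 7 by norm_num)]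
    nlinarith [hQy]
  have hpiece4 : G * (2 * Real.pi * (4 * Tg ^ 2 * Real.exp (-1) * Real.exp (-(Td ^ 2 / (4 * Tg ^ 2)))) / Td ^ 2) ≤ 40 * Q := by
    have hratio : Tg ^ 2 / Td ^ 2 = 4 / L ^ 2 := by rw [hTd]; field_simp; ring
    have hexpo : Real.exp (-(Td ^ 2 / (4 * Tg ^ 2))) ≤ Real.exp (-(6 * L)) := by
      refine Real.exp_le_exp.2 (neg_le_neg ?_)
      rw [hTd, show (Tg * L / 2) ^ 2 / (4 * Tg ^ 2) = L ^ 2 / 16 by field_simp; ring, le_div_iff₀ (by norm_num)]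
      nlinarith
    have hy6 : Real.exp (-(6 * L)) = ((y : ℝ) ^ 6)⁻¹ := by
      have h := exp_neg_natMul_log hy0 6; rw [hL]; exact_mod_cast h
    have he1 : Real.exp (-1) ≤ 1 := Real.exp_le_one_iff.2 (by norm_num)
    have heq : G * (2 * Real.pi * (4 * Tg ^ 2 * Real.exp (-1) * Real.exp (-(Td ^ 2 / (4 * Tg ^ 2)))) / Td ^ 2) =
        8 * Real.pi * Real.exp (-1) * (Tg ^ 2 / Td ^ 2) * (G * Real.exp (-(Td ^ 2 / (4 * Tg ^ 2)))) := by
      field_simp; norm_num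
    rw [heq, hratio]
    have h1 : G * Real.exp (-(Td ^ 2 / (4 * Tg ^ 2))) ≤ (y : ℝ) ^ 2 * ((y : ℝ) ^ 6)⁻¹ :=
      mul_le_mul hG (hexpo.trans hy6.le) (Real.exp_pos _).le (by positivity)
    have h2 : (y : ℝ) ^ 2 * ((y : ℝ) ^ 6)⁻¹ ≤ 1 / y := by
      rw [show (y : ℝ) ^ 2 * ((y : ℝ) ^ 6)⁻¹ = 1 / (y : ℝ) ^ 4 by rw [eq_div_iff (by positivity)]; field_simp]
      exact one_div_le_one_div_of_le hy0 (by nlinarith [pow_le_pow_right₀ hy1.le (show 1 ≤ 4 by norm_num)])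
    have h3 : 4 / L ^ 2 ≤ 1 := by rw [div_le_one (by positivity)]; nlinarith
    have h4 : 0 ≤ G * Real.exp (-(Td ^ 2 / (4 * Tg ^ 2))) := by positivity
    have h5 : 8 * Real.pi * Real.exp (-1) * (4 / L ^ 2) ≤ 40 := by
      have : 8 * Real.pi * Real.exp (-1) ≤ 40 := by nlinarith [Real.exp_pos (-1)]
      calc 8 * Real.pi * Real.exp (-1) * (4 / L ^ 2) ≤ 40 * 1 :=
            mul_le_mul this h3 (by positivity) (by norm_num)
        _ = 40 := mul_one _
    calc 8 * Real.pi * Real.exp (-1) * (4 / L ^ 2) * (G * Real.exp (-(Td ^ 2 / (4 * Tg ^ 2))))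
        ≤ 40 * (1 / y) := mul_le_mul h5 (h1.trans h2) h4 (by norm_num)
      _ ≤ 40 * Q := by nlinarith [hQy]
  have hsplit : (α * sφ) * ((1 + a * τ ^ 2) ^ (-(K / 4)) *
          (Real.sqrt (8 * Real.pi / (a * K)) + 2 * (2 : ℝ) ^ (-(K / 4)) * Real.pi / Real.sqrt a) / α +
        6 * ε * Real.log y + 2 * Real.pi / 3 * ε * Td +
        2 * Real.pi * (4 * Tg ^ 2 * Real.exp (-1) * Real.exp (-(Td ^ 2 / (4 * Tg ^ 2)))) / Td ^ 2) =
      G * (D * (Real.sqrt (8 * Real.pi / (a * K)) + 2 * (2 : ℝ) ^ (-(K / 4)) * Real.pi / Real.sqrt a) / α) +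
        G * (6 * ε * Real.log y) + G * (2 * Real.pi / 3 * ε * Td) +
        G * (2 * Real.pi * (4 * Tg ^ 2 * Real.exp (-1) * Real.exp (-(Td ^ 2 / (4 * Tg ^ 2)))) / Td ^ 2) := by
    rw [hGdef, hD]; ring
  rw [hsplit]
  linarith [hpiece1, hpiece2, hpiece3, hpiece4]

set_option maxHeartbeats 3000000 in
/-- **Gaussian mean, relative size.** With `G = α√φ ≤ y²`, `aK = 4φ/π²`, `K ≥ 64`, `T_d = T_g L/2`, `ε ≤ y^{-9}`,
`α/T_g ≤ 1000 Q`, `1/y ≤ Q`: `(4G/T_g)(√(4π/(aK)) + 2π2^{-K/2}/√a + 2εT_d + e^{-T_d²/T_g²}√π T_g) ≤ 63000 Q`.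
[cite: HildebrandTenenbaum1986, §5] -/
theorem mean_rel_le {α φ Tg Td L ε a K Q : ℝ} {y : ℕ} (hα0 : 0 < α) (hφ0 : 0 < φ) (hTg4 : 4 ≤ Tg)
    (hTd : Td = Tg * L / 2) (ha : 0 < a) (hK64 : 64 ≤ K) (haK : a * K = 4 * φ / Real.pi ^ 2)
    (hL : L = Real.log y) (hL100 : 100 ≤ L) (hy1 : (1 : ℝ) < y) (hε0 : 0 ≤ ε) (hεy : ε ≤ ((y : ℝ) ^ 9)⁻¹)
    (hG : α * Real.sqrt φ ≤ (y : ℝ) ^ 2) (hTgQ : α / Tg ≤ 1000 * Q) (hQy : 1 / (y : ℝ) ≤ Q) :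
    4 * (α * Real.sqrt φ) / Tg * (Real.sqrt (Real.pi / (a * K / 4)) +
        (2 * (2 : ℝ) ^ (-(K / 2)) / a) * Real.pi / (1 / Real.sqrt a) + ε * (2 * Td) +
        Real.exp (-(Td ^ 2 / Tg ^ 2)) * Real.sqrt (Real.pi / (1 / Tg ^ 2))) ≤ 63000 * Q := by
  have hπ := Real.pi_pos
  have hπ3 := Real.pi_gt_three
  have hπ4 : Real.pi < 3.1416 := Real.pi_lt_d4
  have hy0 : (0 : ℝ) < y := by linarith
  set sφ : ℝ := Real.sqrt φ with hsφ
  have hsφ0 : 0 < sφ := Real.sqrt_pos.2 hφ0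
  have hK0 : 0 < K := by linarith
  have hL0 : 0 < L := by linarith
  have hTg0 : 0 < Tg := by linarith
  have hTd0 : 0 < Td := by rw [hTd]; positivity
  have hQ0 : 0 ≤ Q := le_trans (by positivity) hQy
  have hsa0 : 0 < Real.sqrt a := Real.sqrt_pos.2 ha
  have haval : a = 4 * φ / (Real.pi ^ 2 * K) := by
    rw [eq_div_iff (by positivity)]
    calc a * (Real.pi ^ 2 * K) = (a * K) * Real.pi ^ 2 := by ring
      _ = 4 * φ / Real.pi ^ 2 * Real.pi ^ 2 := by rw [haK]
      _ = 4 * φ := by field_simp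
  -- `sφ √(π/(aK/4)) = √(π³) ≤ 5.6`
  have hM1 : sφ * Real.sqrt (Real.pi / (a * K / 4)) ≤ 5.6 := by
    rw [haK, show Real.pi / (4 * φ / Real.pi ^ 2 / 4) = Real.pi ^ 3 / φ by field_simp, hsφ,
      sqrt_mul_sqrt_div hφ0 _, Real.sqrt_le_left (by norm_num)]
    nlinarith
  -- `sφ/√a = π√K/2`, `√K 2^{-K/2} ≤ 1`
  have hsa : sφ / Real.sqrt a = Real.pi / 2 * Real.sqrt K := by
    rw [hsφ, ← Real.sqrt_div hφ0.le, haval, show φ / (4 * φ / (Real.pi ^ 2 * K)) = (Real.pi / 2) ^ 2 * K by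
      field_simp; ring, Real.sqrt_mul (by positivity), Real.sqrt_sq (by positivity)]
  have hsK : Real.sqrt K * (2 : ℝ) ^ (-(K / 2)) ≤ 1 := by
    have h1 := sqrt_le_two_rpow_div_eight hK64
    have h2 : (2 : ℝ) ^ (K / 8) * (2 : ℝ) ^ (-(K / 2)) = (2 : ℝ) ^ (-(3 * K / 8)) := by
      rw [← Real.rpow_add (by norm_num)]; ring_nf
    have h3 : (2 : ℝ) ^ (-(3 * K / 8)) ≤ 1 := Real.rpow_le_one_of_one_le_of_nonpos (by norm_num) (by linarith)
    have h4 : 0 < (2 : ℝ) ^ (-(K / 2)) := Real.rpow_pos_of_pos (by norm_num) _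
    calc Real.sqrt K * (2 : ℝ) ^ (-(K / 2)) ≤ (2 : ℝ) ^ (K / 8) * (2 : ℝ) ^ (-(K / 2)) :=
          mul_le_mul_of_nonneg_right h1 h4.le
      _ = _ := h2
      _ ≤ 1 := h3
  -- `√(π/(1/Tg²)) = √π Tg`
  have hsTg : Real.sqrt (Real.pi / (1 / Tg ^ 2)) = Real.sqrt Real.pi * Tg := by
    rw [show Real.pi / (1 / Tg ^ 2) = Real.pi * Tg ^ 2 by field_simp, Real.sqrt_mul hπ.le, Real.sqrt_sq hTg0.le]
  have hsπ : Real.sqrt Real.pi ≤ 1.78 := by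
    rw [Real.sqrt_le_left (by norm_num)]; nlinarith
  have hsπ0 : 0 ≤ Real.sqrt Real.pi := Real.sqrt_nonneg _
  -- split
  have heq : 4 * (α * sφ) / Tg * (Real.sqrt (Real.pi / (a * K / 4)) +
        (2 * (2 : ℝ) ^ (-(K / 2)) / a) * Real.pi / (1 / Real.sqrt a) + ε * (2 * Td) +
        Real.exp (-(Td ^ 2 / Tg ^ 2)) * Real.sqrt (Real.pi / (1 / Tg ^ 2))) =
      4 * (α / Tg) * (sφ * Real.sqrt (Real.pi / (a * K / 4))) +
        8 * Real.pi * (α / Tg) * ((2 : ℝ) ^ (-(K / 2)) * (sφ / Real.sqrt a)) * (Real.sqrt a * Real.sqrt a / a) +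
        8 * ((α * sφ) * ε) * (Td / Tg) +
        4 * (α * sφ) * Real.exp (-(Td ^ 2 / Tg ^ 2)) * (Real.sqrt (Real.pi / (1 / Tg ^ 2)) / Tg) := by
    field_simp
    ring
  have haa : Real.sqrt a * Real.sqrt a / a = 1 := by rw [Real.mul_self_sqrt ha.le, div_self ha.ne']
  rw [heq, haa, mul_one, hsa, hsTg]
  have hTdTg : Td / Tg = L / 2 := by rw [hTd]; field_simp
  rw [hTdTg, show Real.sqrt Real.pi * Tg / Tg = Real.sqrt Real.pi by field_simp]
  -- the four pieces
  have hp1 : 4 * (α / Tg) * (sφ * Real.sqrt (Real.pi / (a * K / 4))) ≤ 22400 * Q := by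
    have h0 : 0 ≤ sφ * Real.sqrt (Real.pi / (a * K / 4)) := by positivity
    calc 4 * (α / Tg) * (sφ * Real.sqrt (Real.pi / (a * K / 4))) ≤ 4 * (1000 * Q) * 5.6 := by
          have := mul_le_mul hTgQ hM1 h0 (by positivity)
          nlinarith
      _ = 22400 * Q := by ring
  have hp2 : 8 * Real.pi * (α / Tg) * ((2 : ℝ) ^ (-(K / 2)) * (Real.pi / 2 * Real.sqrt K)) ≤ 39500 * Q := by
    have h1 : (2 : ℝ) ^ (-(K / 2)) * (Real.pi / 2 * Real.sqrt K) ≤ Real.pi / 2 := by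
      calc (2 : ℝ) ^ (-(K / 2)) * (Real.pi / 2 * Real.sqrt K) = Real.pi / 2 * (Real.sqrt K * (2 : ℝ) ^ (-(K / 2))) := by
            ring
        _ ≤ Real.pi / 2 * 1 := mul_le_mul_of_nonneg_left hsK (by positivity)
        _ = Real.pi / 2 := mul_one _
    have h0 : 0 ≤ (2 : ℝ) ^ (-(K / 2)) * (Real.pi / 2 * Real.sqrt K) := by positivity
    have hαTg0 : 0 ≤ α / Tg := by positivity
    calc 8 * Real.pi * (α / Tg) * ((2 : ℝ) ^ (-(K / 2)) * (Real.pi / 2 * Real.sqrt K))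
        ≤ 8 * Real.pi * (1000 * Q) * (Real.pi / 2) := by
          have := mul_le_mul hTgQ h1 h0 (by positivity)
          nlinarith
      _ ≤ 39500 * Q := by
          have hπsq' : Real.pi ^ 2 ≤ 9.87 := by nlinarith [Real.pi_lt_d4, Real.pi_pos]
          nlinarith [hπsq', hQ0]
  have hGε : α * sφ * ε ≤ 1 / (y : ℝ) ^ 7 := by
    calc α * sφ * ε ≤ (y : ℝ) ^ 2 * ((y : ℝ) ^ 9)⁻¹ := mul_le_mul hG hεy hε0 (by positivity)
      _ = 1 / (y : ℝ) ^ 7 := by rw [eq_div_iff (by positivity)]; field_simp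
  have hLy : L ≤ y := by
    rw [hL]; exact (Real.log_le_sub_one_of_pos hy0).trans (by linarith)
  have hp3 : 8 * ((α * sφ) * ε) * (L / 2) ≤ 4 * Q := by
    have h2 : α * sφ * ε * L ≤ 1 / (y : ℝ) ^ 7 * y := mul_le_mul hGε hLy hL0.le (by positivity)
    have h3 : 1 / (y : ℝ) ^ 7 * y ≤ 1 / y := by
      rw [div_mul_eq_mul_div, one_mul, div_le_div_iff₀ (by positivity) hy0]
      nlinarith [pow_le_pow_right₀ hy1.le (show 2 ≤ 7 by norm_num)]
    nlinarith [hQy]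
  have hp4 : 4 * (α * sφ) * Real.exp (-(Td ^ 2 / Tg ^ 2)) * Real.sqrt Real.pi ≤ 8 * Q := by
    have hexpo : Real.exp (-(Td ^ 2 / Tg ^ 2)) ≤ Real.exp (-(3 * L)) := by
      refine Real.exp_le_exp.2 (neg_le_neg ?_)
      rw [hTd, show (Tg * L / 2) ^ 2 / Tg ^ 2 = L ^ 2 / 4 by field_simp; ring, le_div_iff₀ (by norm_num)]
      nlinarith
    have hy3 : Real.exp (-(3 * L)) = ((y : ℝ) ^ 3)⁻¹ := by
      have h := exp_neg_natMul_log hy0 3; rw [hL]; exact_mod_cast h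
    have h1 : α * sφ * Real.exp (-(Td ^ 2 / Tg ^ 2)) ≤ (y : ℝ) ^ 2 * ((y : ℝ) ^ 3)⁻¹ :=
      mul_le_mul hG (hexpo.trans hy3.le) (Real.exp_pos _).le (by positivity)
    have h2 : (y : ℝ) ^ 2 * ((y : ℝ) ^ 3)⁻¹ = 1 / y := by rw [eq_div_iff (by positivity)]; field_simp
    rw [h2] at h1
    have h0 : 0 ≤ α * sφ * Real.exp (-(Td ^ 2 / Tg ^ 2)) := by positivity
    calc 4 * (α * sφ) * Real.exp (-(Td ^ 2 / Tg ^ 2)) * Real.sqrt Real.pi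
        = 4 * ((α * sφ * Real.exp (-(Td ^ 2 / Tg ^ 2))) * Real.sqrt Real.pi) := by ring
      _ ≤ 4 * ((1 / y) * 1.78) := by
          have := mul_le_mul h1 hsπ hsπ0 (by positivity)
          nlinarith
      _ ≤ 8 * Q := by nlinarith [hQy]
  linarith [hp1, hp2, hp3, hp4]

end RegimeB

end Literature.NumberTheory.Sieve

end
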